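/-
Copyright: the b2b-balaban T⁴-continuum CRUX team, row NE7b OWNER lineage `t4-ne7b-p1` (gen 127). Project licence.
-/
import Summits.QuantumFields.BalabanUV.T4Continuum.Spine.NE7b.SupFibreGaussianCovariance
import Literature.MathematicalPhysics.QuantumFieldTheory.Balaban1983to89.B14Eq328GaussianIBP

/-!
# GAUSSIAN INTEGRATION BY PARTS ON THE FIBRE: for the Gaussian fluctuation density `e^{−½H(Pz)(Pz)}dz` of (121)∕(271) and every
# bounded `C¹` observable `G` of the field with bounded derivative, `∫ ⟨f, Pz⟩·G(Pz)·e^{−½H(Pz)(Pz)}dz = ∫ DG(Pz)(Cf)·e^{−½H(Pz)(Pz)}dz`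
# with `C = PM_z⁻¹Pᵀ` THE FLUCTUATION COVARIANCE of (271) (chart-free): Glimm–Jaffe (9.1.28) `∫ φ(f)A dφ_C = ∫ ⟨Cf, δA∕δφ⟩dφ_C` read on
# the fibre `range P = ker Q′t` — the engine of every interpolation ∕ cluster-expansion identity of the road's next step ((d2) of
# `SCOPING-d-cluster.md`) (row NE7b, node U5c; (271) + the tree's `B14.Eq328GaussianIBP` BY NAME; [folklore])

Cell `pub-balaban`, sub-cell `t4`, spine estimate NE7b (`T4WeightBudget.RelWeightBound`; the cell's OWN estimate — NOT PRINTED in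
[Bałaban 1983–89], NOT PROVED).  Crux-route work under `Spine/NE7b/` by the row OWNER (`t4-ne7b-p1` gen 127, file (272)) under FREEZE
(0)'s crux-prover clause, on § [NE7bP1-G126-HANDOFF] NEXT (3)(d) ((d1)→(d2) junction), at TEA's level (finite carriers); NOTHING of
Bałaban's is named as a Lean object, valued or asserted; no `T4Continuum/Support` leaf typed; no `def`, no notation; zero `sorry`.  Imports
(BY NAME): the OWNER's (271) `…SupFibreGaussianCovariance` (`chart_apply`, `form_chart_eq`, `chart_posDef`, `covariance_mem_fibre`,
`covariance_fibre_equation`, `covariance_symm`, `fibre_solution_unique`, `fibre_first_moment`, `fibre_second_moment`); the tree's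
`Literature/…/Balaban1983to89/B14Eq328GaussianIBP` (`B14.Eq328GaussianIBP.integral_dotProduct_mul_mul_gaussDensity` — Stein ∕ Wick for
bounded `C¹` test functions against `e^{−½vᵀQv}dv`, [GlimmJaffe1987] (9.1.28) in finite dimensions, 0 sorry); Mathlib's `fderiv_comp`,
`ContinuousLinearMap.fderiv`, `ContinuousLinearMap.opNorm_comp_le`.

WHY (located).  (271) identified the MEASURE (`gaussProb M_z` in the chart) and its covariance `C`.  Every expansion step of the
non-quadratic part (Mayer ∕ decoupling interpolation, the `t`-derivative formulas of [Balaban1988Convergent] (3.28)) differentiates a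
Gaussian expectation and integrates by parts; the one identity needed is (9.1.28) for THIS measure with THIS covariance.  In the chart
the linear observable `⟨f, Pz⟩` is `zᵀ(Pᵀf)`, the observable is `G ∘ P` (bounded `C¹` with `‖D(G∘P)‖ ≤ C₁‖P‖`), the tree's precision-form
IBP gives the direction `M_z⁻¹Pᵀf`, and the chain rule turns `D(G∘P)(z)(M_z⁻¹Pᵀf)` into `DG(Pz)(PM_z⁻¹Pᵀf) = DG(Pz)(Cf)` — (271)'s
`covariance_mem_fibre` verbatim.  So the covariance that appears in every IBP identity of the road IS the fluctuation covariance.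

WHAT IS PROVED ([folklore]; `ι`, `σ` finite, `H` symmetric with floor `m > 0`, chart bound `p > 0`, `M_z(j,k) = H(Pe_j)(Pe_k)`):
* §1 `pairing_eq_dotProduct` (`Σ_x f_x(Pz)_x = zᵀ(Pᵀf)`), `fderiv_comp_chart` (`D(G∘P)(z)v = DG(Pz)(Pv)`), `norm_fderiv_comp_chart_le`.
* §2 **`fibre_gaussian_ibp`** (THE IDENTITY with `C = PM_z⁻¹Pᵀ` displayed).
* §3 THE END **`fibre_gaussian_ibp_covariance`** (`∃ C` with ALL of (271)'s clauses — symmetric, `Cf` in the fibre with the fibre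
  equation, uniqueness, `Z > 0`, mean zero, second moments — AND the IBP identity for every bounded `C¹` `G` and every `f`); §4 toy.

HONEST (what this is NOT).  One chain rule over the tree's (9.1.28); bounded `C¹` observables only (the tree's `…_of_integrable` variant
covers polynomial observables when wanted); no tilted ∕ interpolated measure yet ((9.1.32) is the tree's `eq328_tilted_ibp`, to be read on
the fibre the same way); nothing of the non-Gaussian fluctuation measure; scalar skeleton ((A3), NC-NE7b-α UNRULED); nothing of Bałaban's
asserted.  BY-NAME EFFECT ON THE WALL: NONE.  NE7b NOT PRINTED ∕ NOT PROVED; spine PROVED 0∕9; rung (B)+1 — the programme's measures remain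
FINITE-torus statements; NOT the mass gap, NOT Clay.  HONEST DEPENDENCY: continuum YM on T⁴ ⇐ BetaPertH ∧ nine spine estimates (0∕9
proved); BetaPertH ⇐ (D1) ∧ (D4) ∧ CAP+tail; G-an2-4 gates asym, D1 and NE2∕3∕4.
-/

set_option autoImplicit false

noncomputable section

namespace Summit.QuantumFields.BalabanUV.T4Continuum.NE7b.SupFibreGaussianIBP

open MeasureTheory Real Matrix
open Literature.MathematicalPhysics.QuantumFieldTheory.Balaban1983to89
open B14.Eq328GaussianIBP (integral_dotProduct_mul_mul_gaussDensity)
open SupFibreGaussianCovariance (chart_apply form_chart_eq chart_posDef covariance_mem_fibre covariance_fibre_equation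
  covariance_symm fibre_solution_unique fibre_first_moment fibre_second_moment)
open SupConvexStepGaussianExact (formIntegral_pos)

variable {ι : Type*} [Fintype ι] {σ : Type} [Fintype σ] [DecidableEq σ]
  {H : (ι → ℝ) →L[ℝ] (ι → ℝ) →L[ℝ] ℝ} {m p : ℝ} (P : (σ → ℝ) →L[ℝ] (ι → ℝ))

/-! ## §1. The linear observable and the chain rule in the chart -/

/-- **THE LINEAR OBSERVABLE IN THE CHART**: `Σ_x f_x(Pz)_x = zᵀ(Pᵀf)` with `(Pᵀf)_k = Σ_y (Pe_k)_y f_y`. [folklore] -/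
theorem pairing_eq_dotProduct (f : ι → ℝ) (z : σ → ℝ) :
    ∑ x, f x * P z x = z ⬝ᵥ fun k => ∑ y, P (Pi.single k 1) y * f y := by
  rw [show (∑ x, f x * P z x) = ∑ x, f x * ∑ k, z k * P (Pi.single k 1) x from
    Finset.sum_congr rfl fun x _ => by rw [chart_apply P z x]]
  simp only [dotProduct, Finset.mul_sum]
  rw [Finset.sum_comm]
  exact Finset.sum_congr rfl fun k _ => Finset.sum_congr rfl fun x _ => by ring

omit [DecidableEq σ] in
/-- **CHAIN RULE IN THE CHART**: `G` differentiable at `Pz` ⟹ `D(G ∘ P)(z)v = DG(Pz)(Pv)`. [folklore] -/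
theorem fderiv_comp_chart {G : (ι → ℝ) → ℝ} (z : σ → ℝ) (hG : DifferentiableAt ℝ G (P z)) (v : σ → ℝ) :
    fderiv ℝ (G ∘ P) z v = fderiv ℝ G (P z) (P v) := by
  rw [fderiv_comp z hG P.differentiableAt, P.fderiv]
  rfl

omit [DecidableEq σ] in
/-- The derivative of `G ∘ P` is bounded by `‖DG(Pz)‖·‖P‖`. [folklore] -/
theorem norm_fderiv_comp_chart_le {G : (ι → ℝ) → ℝ} (z : σ → ℝ) (hG : DifferentiableAt ℝ G (P z)) :
    ‖fderiv ℝ (G ∘ P) z‖ ≤ ‖fderiv ℝ G (P z)‖ * ‖P‖ := by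
  rw [fderiv_comp z hG P.differentiableAt, P.fderiv]
  exact ContinuousLinearMap.opNorm_comp_le _ _

/-! ## §2. The identity -/

/-- **GAUSSIAN INTEGRATION BY PARTS ON THE FIBRE**: `H` symmetric with floor `m·Σh² ≤ H h h` (`m > 0`), chart bound `p·Σz² ≤ Σ(Pz)²`
(`p > 0`), `M_z(j,k) = H(Pe_j)(Pe_k)`, `G ∈ C¹` bounded with bounded derivative ⟹ for every `f`,
`∫ ⟨f,Pz⟩G(Pz)e^{−½H(Pz)(Pz)}dz = ∫ DG(Pz)(PM_z⁻¹Pᵀf)e^{−½H(Pz)(Pz)}dz`. [folklore] -/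
theorem fibre_gaussian_ibp (hHsym : ∀ h k : ι → ℝ, H h k = H k h) (hfl : ∀ h : ι → ℝ, m * ∑ x, h x ^ 2 ≤ H h h) (hm : 0 < m)
    (hP : ∀ z : σ → ℝ, p * ∑ i, z i ^ 2 ≤ ∑ x, P z x ^ 2) (hp : 0 < p) (Mz : Matrix σ σ ℝ)
    (hMz : ∀ j k, Mz j k = H (P (Pi.single j 1)) (P (Pi.single k 1))) {G : (ι → ℝ) → ℝ} (hG : ContDiff ℝ 1 G) {C₀ C₁ : ℝ}
    (h0 : ∀ v, ‖G v‖ ≤ C₀) (h1 : ∀ v, ‖fderiv ℝ G v‖ ≤ C₁) (f : ι → ℝ) :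
    ∫ z : σ → ℝ, (∑ x, f x * P z x) * G (P z) * exp (-((1 / 2 : ℝ) * H (P z) (P z)))
      = ∫ z : σ → ℝ, fderiv ℝ G (P z) (fun x => ∑ y, (∑ j, ∑ k, P (Pi.single j 1) x * Mz⁻¹ j k * P (Pi.single k 1) y) * f y)
          * exp (-((1 / 2 : ℝ) * H (P z) (P z))) := by
  have hpd := chart_posDef P hHsym hfl hm hP hp Mz hMz
  have hGd : Differentiable ℝ G := hG.differentiable one_ne_zero
  -- the observable in the chart
  have hGP : ContDiff ℝ 1 (G ∘ P) := hG.comp P.contDiff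
  have h0' : ∀ z : σ → ℝ, ‖(G ∘ P) z‖ ≤ C₀ := fun z => h0 (P z)
  have hC₁ : 0 ≤ C₁ := (norm_nonneg _).trans (h1 0)
  have h1' : ∀ z : σ → ℝ, ‖fderiv ℝ (G ∘ P) z‖ ≤ C₁ * ‖P‖ := fun z =>
    (norm_fderiv_comp_chart_le P z (hGd _)).trans (mul_le_mul_of_nonneg_right (h1 _) (norm_nonneg _))
  -- the tree's precision-form IBP for `gaussDensity M_z`
  have key := integral_dotProduct_mul_mul_gaussDensity Mz hpd hGP h0' h1' (fun k => ∑ y, P (Pi.single k 1) y * f y)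
  -- read both sides through the chart
  have hρ : ∀ z : σ → ℝ, exp (-(1 / 2 : ℝ) * (z ⬝ᵥ Mz *ᵥ z)) = exp (-((1 / 2 : ℝ) * H (P z) (P z))) := fun z => by
    rw [form_chart_eq P Mz hMz, neg_mul]
  have hL : ∀ z : σ → ℝ, (z ⬝ᵥ fun k => ∑ y, P (Pi.single k 1) y * f y) * (G ∘ P) z * exp (-(1 / 2 : ℝ) * (z ⬝ᵥ Mz *ᵥ z))
      = (∑ x, f x * P z x) * G (P z) * exp (-((1 / 2 : ℝ) * H (P z) (P z))) := fun z => by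
    rw [← pairing_eq_dotProduct P f z, hρ z]
    rfl
  have hR : ∀ z : σ → ℝ, fderiv ℝ (G ∘ P) z (Mz⁻¹ *ᵥ fun k => ∑ y, P (Pi.single k 1) y * f y) * exp (-(1 / 2 : ℝ) * (z ⬝ᵥ Mz *ᵥ z))
      = fderiv ℝ G (P z) (fun x => ∑ y, (∑ j, ∑ k, P (Pi.single j 1) x * Mz⁻¹ j k * P (Pi.single k 1) y) * f y)
          * exp (-((1 / 2 : ℝ) * H (P z) (P z))) := fun z => by
    rw [fderiv_comp_chart P z (hGd _), covariance_mem_fibre P Mz f, hρ z]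
  simp_rw [hL, hR] at key
  exact key

/-! ## §3. THE END: one covariance for the moments, the fibre equation and integration by parts -/

/-- **HEADLINE — THE FLUCTUATION COVARIANCE IS THE COVARIANCE OF GAUSSIAN INTEGRATION BY PARTS ON THE FIBRE.**  Under (271)'s hypotheses
(`H` symmetric with floor, chart bound): `∃ C` with ALL of (271)'s clauses — symmetric; every `Cf` a field of the fibre whose `H`-pairing with
the fibre reproduces `f`; uniqueness of such fields (chart-freeness); `Z > 0`; mean zero; second moments `C(x,y)·Z` — AND, for every bounded `C¹`
observable `G` with bounded derivative and every `f`, `∫ ⟨f,Pz⟩G(Pz)e^{−½H(Pz)(Pz)}dz = ∫ DG(Pz)(Cf)e^{−½H(Pz)(Pz)}dz`. [folklore] -/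
theorem fibre_gaussian_ibp_covariance (hHsym : ∀ h k : ι → ℝ, H h k = H k h) (hfl : ∀ h : ι → ℝ, m * ∑ x, h x ^ 2 ≤ H h h)
    (hm : 0 < m) (hP : ∀ z : σ → ℝ, p * ∑ i, z i ^ 2 ≤ ∑ x, P z x ^ 2) (hp : 0 < p) :
    ∃ C : ι → ι → ℝ,
      (∀ x y, C x y = C y x) ∧
      (∀ f : ι → ℝ, (∃ w : σ → ℝ, P w = fun x => ∑ y, C x y * f y) ∧
        ∀ ζ : σ → ℝ, H (fun x => ∑ y, C x y * f y) (P ζ) = ∑ y, f y * P ζ y) ∧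
      (∀ (f u : ι → ℝ), (∃ w : σ → ℝ, P w = u) → (∀ ζ : σ → ℝ, H u (P ζ) = ∑ y, f y * P ζ y) →
        u = fun x => ∑ y, C x y * f y) ∧
      0 < ∫ z : σ → ℝ, exp (-((1 / 2 : ℝ) * H (P z) (P z))) ∧
      (∀ x, ∫ z : σ → ℝ, P z x * exp (-((1 / 2 : ℝ) * H (P z) (P z))) = 0) ∧
      (∀ x y, ∫ z : σ → ℝ, P z x * P z y * exp (-((1 / 2 : ℝ) * H (P z) (P z)))
        = C x y * ∫ z : σ → ℝ, exp (-((1 / 2 : ℝ) * H (P z) (P z)))) ∧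
      (∀ (G : (ι → ℝ) → ℝ) (C₀ C₁ : ℝ), ContDiff ℝ 1 G → (∀ v, ‖G v‖ ≤ C₀) → (∀ v, ‖fderiv ℝ G v‖ ≤ C₁) →
        ∀ f : ι → ℝ, ∫ z : σ → ℝ, (∑ x, f x * P z x) * G (P z) * exp (-((1 / 2 : ℝ) * H (P z) (P z)))
          = ∫ z : σ → ℝ, fderiv ℝ G (P z) (fun x => ∑ y, C x y * f y) * exp (-((1 / 2 : ℝ) * H (P z) (P z)))) := by
  classical
  obtain ⟨Mz, hMz⟩ : ∃ Mz : Matrix σ σ ℝ, ∀ j k, Mz j k = H (P (Pi.single j 1)) (P (Pi.single k 1)) :=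
    ⟨Matrix.of fun j k => H (P (Pi.single j 1)) (P (Pi.single k 1)), fun _ _ => rfl⟩
  refine ⟨fun x y => ∑ j, ∑ k, P (Pi.single j 1) x * Mz⁻¹ j k * P (Pi.single k 1) y,
    fun x y => covariance_symm P hHsym Mz hMz x y,
    fun f => ⟨⟨_, covariance_mem_fibre P Mz f⟩, fun ζ => covariance_fibre_equation P hHsym hfl hm hP hp Mz hMz f ζ⟩,
    fun f u hu hfib => ?_, formIntegral_pos P hfl hm hP hp, fun x => fibre_first_moment P hHsym hfl hm hP hp Mz hMz x,
    fun x y => fibre_second_moment P hHsym hfl hm hP hp Mz hMz x y,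
    fun G C₀ C₁ hG h0 h1 f => fibre_gaussian_ibp P hHsym hfl hm hP hp Mz hMz hG h0 h1 f⟩
  exact fibre_solution_unique P hfl hm hu ⟨_, covariance_mem_fibre P Mz f⟩ fun ζ => by
    rw [hfib ζ, covariance_fibre_equation P hHsym hfl hm hP hp Mz hMz f ζ]

/-! ## §4. Toy -/

/-- Toy: with the constant observable `G = 1` (so `DG = 0`) the identity of §3 says the first moment of `⟨f, Pz⟩` vanishes —
consistent with the mean-zero clause. Here: the headline applies on `Fin 1` with `P = id`, `H h k = h 0·k 0`. -/
example : ∃ C : Fin 1 → Fin 1 → ℝ, ∀ f : Fin 1 → ℝ,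
    ∫ z : Fin 1 → ℝ, (∑ x, f x * (ContinuousLinearMap.id ℝ (Fin 1 → ℝ)) z x) * (fun _ => (1 : ℝ)) ((ContinuousLinearMap.id ℝ _) z)
        * exp (-((1 / 2 : ℝ) * (z 0 * z 0)))
      = ∫ z : Fin 1 → ℝ, fderiv ℝ (fun _ : Fin 1 → ℝ => (1 : ℝ)) ((ContinuousLinearMap.id ℝ _) z) (fun x => ∑ y, C x y * f y)
        * exp (-((1 / 2 : ℝ) * (z 0 * z 0))) := by
  obtain ⟨H, hH⟩ : ∃ H : (Fin 1 → ℝ) →L[ℝ] (Fin 1 → ℝ) →L[ℝ] ℝ, ∀ h k, H h k = h 0 * k 0 :=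
    ⟨((ContinuousLinearMap.mul ℝ ℝ).comp (ContinuousLinearMap.proj 0)).flip.comp (ContinuousLinearMap.proj 0) |>.flip,
      fun h k => by simp⟩
  have hsum : ∀ h : Fin 1 → ℝ, ∑ x, h x ^ 2 = h 0 ^ 2 := fun h => by simp
  obtain ⟨C, -, -, -, -, -, -, hibp⟩ := fibre_gaussian_ibp_covariance (ContinuousLinearMap.id ℝ (Fin 1 → ℝ)) (m := 1) (p := 1)
    (fun h k => by rw [hH, hH, mul_comm]) (fun h => by rw [hH, hsum]; nlinarith) one_pos (fun z => by simp) one_pos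
  refine ⟨C, fun f => ?_⟩
  have h := hibp (fun _ => 1) 1 0 contDiff_const (fun v => by simp) (fun v => by simp) f
  simp only [hH] at h
  exact h

end Summit.QuantumFields.BalabanUV.T4Continuum.NE7b.SupFibreGaussianIBP
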